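import Summits.CriticalPhenomena.CardyFormulaZ2.Theorems.CardyIKTransportIKLinearTransportLine
import Summits.CriticalPhenomena.CardyFormulaZ2.Theorems.CardyFlipRussoSquareFromVoronoiHubDecimateMeasure
import Literature.Probability.Percolation.SitePercolationMeasure

/-!
# Stub `stub_ExchangeChain` (line `pinned-diagram-exchange`, crux stmt-CriticalPhenomena-5076)

M0 "chain bookkeeping" of the reshape v15 of `stub_WindowTransportFar` (Manolescu's transport,
arXiv:2502.08394 §5.3, slides honeycomb face columns through the isotropic window by a long SEQUENCE
of adjacent-column exchanges). The single exchange maps `IsExchangeKernel C c S i T` (Fact 5.15 for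
the IK colour field; landed as `exchangeKernels_IK`, here taken as the HYPOTHESIS of the stub) compose
along any finite admissible schedule `(S t, i t)_{t < n}` (`i t ∈ S t ↔ i t + 1 ∉ S t`,
`S (t+1) = S t ∆ {i t, i t + 1}`) into ONE map `Tc : Obs → Rnd → Obs` of the same shape: measurable,
transporting `ν_{S 0} ⊗ β` to `ν_{S n}`, preserving almost surely the colours off the swept cell
columns, the diagonal flags off the swept face columns and the monochromatic-cluster membership of
cells off the swept cell columns, and covariant under vertical shifts.

Construction (induction on `n`, the schedule being shifted by one at each step): the fresh randomness
`u : Rnd = Set (Site 2 × ℕ)` is split cell by cell into its bits of EVEN index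
`{q | (q.1, 2 q.2) ∈ u}` (consumed by the first exchange) and of ODD index `{q | (q.1, 2 q.2 + 1) ∈ u}`
(handed to the remaining exchanges). The splitting carries `β` to `β ⊗ β`
(`sitePercolation_map_relabel` along the even/odd relabelling `Equiv.natSumNatEquivNat`, then
`sitePercolation_map_split`) and commutes with vertical shifts definitionally, so the composed map is a
composition of measure-preserving maps `ν_{S 0} ⊗ β → ν_{S 1} ⊗ β → ν_{S n}`, and the almost-sure
clauses of the single steps pull back along measure-preserving maps.
-/

noncomputable section

namespace Summit.CriticalPhenomena.CardyFormulaZ2.Theorems.IKLinearTransport.PinnedDiagramExchange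

open scoped BigOperators Topology Classical MeasureTheory ProbabilityTheory ENNReal symmDiff
open Filter Set Function MeasureTheory
open Literature.Probability.Percolation Literature.Probability.LatticeModels
open Literature.Probability.RandomPlanarGeometry

namespace ExchangeChain

open Summit.CriticalPhenomena.CardyFormulaZ2.Cruxes.SquareFromVoronoiHub.CentreDecimation.stub_decimateMeasureAux
  (measurable_split sitePercolation_map_split)

/-! ## §1 Splitting the fresh randomness into even and odd bits -/

/-- The law `ν_S` of the observables is s-finite (a push-forward of the finite gauge measure `μIK`).
[folklore] -/
theorem sFinite_nuMix (S : Set ℤ) : SFinite (νmix S) := by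
  unfold νmix μIK; infer_instance

/-- Reading the bits of even index (cell by cell) is measurable. [folklore] -/
theorem measurable_even : Measurable fun u : Rnd => ({q | (q.1, 2 * q.2) ∈ u} : Rnd) :=
  measurable_set_iff.2 fun q => measurable_set_mem (q.1, 2 * q.2)

/-- Reading the bits of odd index (cell by cell) is measurable. [folklore] -/
theorem measurable_odd : Measurable fun u : Rnd => ({q | (q.1, 2 * q.2 + 1) ∈ u} : Rnd) :=
  measurable_set_iff.2 fun q => measurable_set_mem (q.1, 2 * q.2 + 1)

/-- SPLITTING THE RANDOMNESS: reading off the bits of even and of odd index, cell by cell, carries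
`β` to `β ⊗ β` (relabelling invariance of the product Bernoulli measure along the even/odd bijection
`Site 2 × ℕ ≃ (Site 2 × ℕ) ⊕ (Site 2 × ℕ)`, then independence of the two blocks of a sum type).
[folklore] -/
theorem beta_map_split :
    β.map (fun u : Rnd => (({q | (q.1, 2 * q.2) ∈ u} : Rnd), ({q | (q.1, 2 * q.2 + 1) ∈ u} : Rnd))) =
      β.prod β := by
  -- the even/odd relabelling of the bit index, cell by cell
  let e : (Site 2 × ℕ) ≃ (Site 2 × ℕ) ⊕ (Site 2 × ℕ) :=
    ((Equiv.refl (Site 2)).prodCongr Equiv.natSumNatEquivNat.symm).trans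
      (Equiv.prodSumDistrib (Site 2) ℕ ℕ)
  have hcomp : (fun u : Rnd =>
      (({q | (q.1, 2 * q.2) ∈ u} : Rnd), ({q | (q.1, 2 * q.2 + 1) ∈ u} : Rnd))) =
      (fun ω : Set ((Site 2 × ℕ) ⊕ (Site 2 × ℕ)) => ({a | Sum.inl a ∈ ω}, {b | Sum.inr b ∈ ω})) ∘
        SiteConfig.relabel e := by
    funext u
    simp only [Function.comp_apply, SiteConfig.mem_relabel_iff]
    rfl
  rw [hcomp, ← Measure.map_map (measurable_split _ _) (SiteConfig.relabel e).measurable,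
    show β = sitePercolation (Site 2 × ℕ) half from rfl, sitePercolation_map_relabel,
    sitePercolation_map_split]

/-- Reading the bits of even index is measure preserving `β → β`. [folklore] -/
theorem measurePreserving_even :
    MeasurePreserving (fun u : Rnd => ({q | (q.1, 2 * q.2) ∈ u} : Rnd)) β β := by
  haveI : IsProbabilityMeasure β := by unfold β; infer_instance
  exact (measurePreserving_fst (μ := β) (ν := β)).comp
    ⟨measurable_even.prodMk measurable_odd, beta_map_split⟩

/-! ## §2 Transfer lemmas -/

/-- Almost-sure statements pull back along measure-preserving maps. [folklore] -/
theorem ae_comp {α γ : Type*} [MeasurableSpace α] [MeasurableSpace γ] {μ : Measure α}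
    {ν : Measure γ} {f : α → γ} (hf : MeasurePreserving f μ ν) {p : γ → Prop}
    (hp : ∀ᵐ y ∂ν, p y) : ∀ᵐ x ∂μ, p (f x) := by
  refine ae_of_ae_map hf.aemeasurable ?_
  rw [hf.map_eq]
  exact hp

/-- Keeping the state and reading the even bits preserves `ν ⊗ β`. [folklore] -/
theorem measurePreserving_keepEven (ν₀ : Measure Obs) [SFinite ν₀] :
    MeasurePreserving (fun xu : Obs × Rnd => (xu.1, ({q | (q.1, 2 * q.2) ∈ xu.2} : Rnd)))
      (ν₀.prod β) (ν₀.prod β) := by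
  haveI : IsProbabilityMeasure β := by unfold β; infer_instance
  exact (MeasurePreserving.id ν₀).prod measurePreserving_even

/-- ONE STEP OF THE CHAIN, transport: if `(x, u) ↦ T₀ x u` carries `ν₀ ⊗ β` to `ν₁`, then
`(x, u) ↦ (T₀ x u_even, u_odd)` carries `ν₀ ⊗ β` to `ν₁ ⊗ β` (split `β = β ⊗ β`, re-associate,
apply `T₀` to the first two factors). [folklore] -/
theorem measurePreserving_step {ν₀ ν₁ : Measure Obs} [SFinite ν₀] {T₀ : Obs → Rnd → Obs}
    (h₀ : MeasurePreserving (Function.uncurry T₀) (ν₀.prod β) ν₁) :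
    MeasurePreserving (fun xu : Obs × Rnd =>
        (T₀ xu.1 {q | (q.1, 2 * q.2) ∈ xu.2}, ({q | (q.1, 2 * q.2 + 1) ∈ xu.2} : Rnd)))
      (ν₀.prod β) (ν₁.prod β) := by
  haveI : IsProbabilityMeasure β := by unfold β; infer_instance
  have h1 : MeasurePreserving (Prod.map id (fun u : Rnd =>
      (({q | (q.1, 2 * q.2) ∈ u} : Rnd), ({q | (q.1, 2 * q.2 + 1) ∈ u} : Rnd))))
      (ν₀.prod β) (ν₀.prod (β.prod β)) :=
    (MeasurePreserving.id ν₀).prod ⟨measurable_even.prodMk measurable_odd, beta_map_split⟩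
  have h2 : MeasurePreserving (MeasurableEquiv.prodAssoc (α := Obs) (β := Rnd) (γ := Rnd)).symm
      (ν₀.prod (β.prod β)) ((ν₀.prod β).prod β) :=
    MeasurePreserving.symm _ (measurePreserving_prodAssoc ν₀ β β)
  have h3 : MeasurePreserving (Prod.map (Function.uncurry T₀) id) ((ν₀.prod β).prod β)
      (ν₁.prod β) :=
    h₀.prod (MeasurePreserving.id β)
  exact h3.comp (h2.comp h1)

end ExchangeChain

/-! ## §3 The registered stub -/

/-- STUB `stub_ExchangeChain` (M0 of the reshape v15 of `stub_WindowTransportFar`, line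
`pinned-diagram-exchange`): the exchange kernels (hypothesis, of shape `exchangeKernels_IK`) compose
along every finite admissible schedule `(S t, i t)_{t<n}` into one map `Tc : Obs → Rnd → Obs` which is
measurable, transports `ν_{S 0} ⊗ β` to `ν_{S n}`, preserves almost surely the colours of the cells
off the swept cell columns `i t + 1`, the diagonal flags off the swept face columns `i t, i t + 1` and
the monochromatic-cluster membership of any two cells off the swept cell columns, and is covariant
under vertical shifts. Induction on `n`: `Tc x u := Tc' (T₀ x u_even) u_odd` with `T₀` the kernel of
the first step and `Tc'` the chain of the shifted schedule. [folklore] -/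
theorem stub_ExchangeChain :
    (∃ C c : ℝ, 0 < c ∧ ∀ (S : Set ℤ) (i : ℤ), (i ∈ S ↔ i + 1 ∉ S) →
        ∃ T : Obs → Rnd → Obs, IsExchangeKernel C c S i T) →
    ∀ (n : ℕ) (S : ℕ → Set ℤ) (i : ℕ → ℤ),
      (∀ t : ℕ, t < n → (i t ∈ S t ↔ i t + 1 ∉ S t) ∧ S (t + 1) = S t ∆ {i t, i t + 1}) →
      ∃ Tc : Obs → Rnd → Obs, Measurable (Function.uncurry Tc) ∧
        ((νmix (S 0)).prod β).map (Function.uncurry Tc) = νmix (S n) ∧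
        (∀ᵐ xu ∂((νmix (S 0)).prod β),
          (∀ v : Site 2, (∀ t : ℕ, t < n → v 0 ≠ i t + 1) → (v ∈ (Tc xu.1 xu.2).1 ↔ v ∈ xu.1.1)) ∧
          (∀ f : Site 2, (∀ t : ℕ, t < n → f 0 ≠ i t ∧ f 0 ≠ i t + 1) →
            (f ∈ (Tc xu.1 xu.2).2 ↔ f ∈ xu.1.2)) ∧
          (∀ a b : Site 2, (∀ t : ℕ, t < n → a 0 ≠ i t + 1) → (∀ t : ℕ, t < n → b 0 ≠ i t + 1) →
            (b ∈ monoCluster (Tc xu.1 xu.2) a ↔ b ∈ monoCluster xu.1 a))) ∧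
        (∀ (m : ℤ) (x : Obs) (u : Rnd), Tc (vshift m x) (ushift m u) = vshift m (Tc x u)) := by
  rintro ⟨C, c, -, hK⟩ n
  induction n with
  | zero =>
    intro S i _
    haveI : IsProbabilityMeasure β := by unfold β; infer_instance
    haveI := ExchangeChain.sFinite_nuMix (S 0)
    refine ⟨fun x _ => x, measurable_fst, ?_,
      Eventually.of_forall fun xu => ⟨fun v _ => Iff.rfl, fun f _ => Iff.rfl, fun a b _ _ => Iff.rfl⟩,
      fun m x u => rfl⟩
    change ((νmix (S 0)).prod β).map Prod.fst = νmix (S 0)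
    rw [Measure.map_fst_prod, measure_univ, one_smul]
  | succ n ih =>
    intro S i hS
    obtain ⟨h0, hS1⟩ := hS 0 n.succ_pos
    have hS1' : S 1 = S 0 ∆ {i 0, i 0 + 1} := hS1
    obtain ⟨T₀, hTm, hTlaw, hTae, hTcov, -⟩ := hK (S 0) (i 0) h0
    obtain ⟨Tc', hm', hlaw', hae', hcov'⟩ :=
      ih (fun t => S (t + 1)) (fun t => i (t + 1)) fun t ht => hS (t + 1) (Nat.succ_lt_succ ht)
    -- the induction hypothesis on the shifted schedule, restated (definitional unfolding)
    have hlaw₁ : ((νmix (S 1)).prod β).map (Function.uncurry Tc') = νmix (S (n + 1)) := hlaw'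
    have hae₁ : ∀ᵐ xu ∂((νmix (S 1)).prod β),
        (∀ v : Site 2, (∀ t : ℕ, t < n → v 0 ≠ i (t + 1) + 1) →
          (v ∈ (Tc' xu.1 xu.2).1 ↔ v ∈ xu.1.1)) ∧
        (∀ f : Site 2, (∀ t : ℕ, t < n → f 0 ≠ i (t + 1) ∧ f 0 ≠ i (t + 1) + 1) →
          (f ∈ (Tc' xu.1 xu.2).2 ↔ f ∈ xu.1.2)) ∧
        (∀ a b : Site 2, (∀ t : ℕ, t < n → a 0 ≠ i (t + 1) + 1) →
          (∀ t : ℕ, t < n → b 0 ≠ i (t + 1) + 1) →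
          (b ∈ monoCluster (Tc' xu.1 xu.2) a ↔ b ∈ monoCluster xu.1 a)) := hae'
    haveI : IsProbabilityMeasure β := by unfold β; infer_instance
    haveI := ExchangeChain.sFinite_nuMix (S 0)
    haveI := ExchangeChain.sFinite_nuMix (S 1)
    -- the first step as a measure-preserving map `ν_{S 0} ⊗ β → ν_{S 1}`
    have hT₀ : MeasurePreserving (Function.uncurry T₀) ((νmix (S 0)).prod β) (νmix (S 1)) :=
      ⟨hTm, by rw [hTlaw, hS1']⟩
    have hstep := ExchangeChain.measurePreserving_step hT₀
    have hkeep := ExchangeChain.measurePreserving_keepEven (νmix (S 0))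
    refine ⟨fun x u => Tc' (T₀ x {q | (q.1, 2 * q.2) ∈ u}) {q | (q.1, 2 * q.2 + 1) ∈ u},
      hm'.comp hstep.measurable, ?_, ?_, ?_⟩
    · -- law transport: `ν_{S 0} ⊗ β → ν_{S 1} ⊗ β → ν_{S (n+1)}`
      change ((νmix (S 0)).prod β).map (Function.uncurry Tc' ∘ fun xu : Obs × Rnd =>
        (T₀ xu.1 {q | (q.1, 2 * q.2) ∈ xu.2}, ({q | (q.1, 2 * q.2 + 1) ∈ xu.2} : Rnd))) =
          νmix (S (n + 1))
      rw [← Measure.map_map hm' hstep.measurable, hstep.map_eq, hlaw₁]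
    · -- almost-sure clauses: pull back the first step's clause along `(x, u) ↦ (x, u_even)` and the
      -- remaining steps' clause along `(x, u) ↦ (T₀ x u_even, u_odd)`, then chain the equivalences
      have h1 := ExchangeChain.ae_comp hkeep hTae
      have h2 := ExchangeChain.ae_comp hstep hae₁
      filter_upwards [h1, h2] with xu hx1 hx2
      obtain ⟨hc1, hf1, hm1⟩ := hx1
      obtain ⟨hc2, hf2, hm2⟩ := hx2
      refine ⟨fun v hv => ?_, fun f hf => ?_, fun a b ha hb => ?_⟩
      · exact (hc2 v fun t ht => hv (t + 1) (Nat.succ_lt_succ ht)).trans (hc1 v (hv 0 n.succ_pos))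
      · exact (hf2 f fun t ht => hf (t + 1) (Nat.succ_lt_succ ht)).trans
          (hf1 f (hf 0 n.succ_pos).1 (hf 0 n.succ_pos).2)
      · exact (hm2 a b (fun t ht => ha (t + 1) (Nat.succ_lt_succ ht))
          fun t ht => hb (t + 1) (Nat.succ_lt_succ ht)).trans
            (hm1 a b (ha 0 n.succ_pos) (hb 0 n.succ_pos))
    · -- vertical covariance (the even/odd splitting commutes with `ushift` definitionally)
      intro m x u
      change Tc' (T₀ (vshift m x) (ushift m {q | (q.1, 2 * q.2) ∈ u}))
          (ushift m {q | (q.1, 2 * q.2 + 1) ∈ u}) =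
        vshift m (Tc' (T₀ x {q | (q.1, 2 * q.2) ∈ u}) {q | (q.1, 2 * q.2 + 1) ∈ u})
      rw [hTcov, hcov']

end Summit.CriticalPhenomena.CardyFormulaZ2.Theorems.IKLinearTransport.PinnedDiagramExchange

end
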